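import Summits.QuantumFields.BalabanUV.Beta.EriceFlowEnclosureB12AsPrintedHistoryJump

/-!
# Beta / EriceFlowEnclosureB12AsPrintedHistoryJumpRuns — the continuity letter of Theorem 2 on the as-printed interface of [I],
# part 2: the runs of the history-jump family (forward solutions of (0.20)), Theorem 3's run hypothesis at every depth, the
# depth-2 read-out, and **¬ Theorem 2 AS PRINTED** whenever the read-out misses arbitrarily large values (β-flow team, prover 1,
# unit `b2b-balaban-beta-bflow-p1`, gen 33; ROW AP-I; PART 1 = `…B12AsPrintedHistoryJump` (the family and its letters), PART 3 =
# `…B12AsPrintedHistoryJumpEnd` (one explicit J, the toy setting, the headlines))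

HONEST FRAMING (page 1 of everything the β sub-cell writes): discharging `BetaPertH` makes Bałaban's UV stability UNCONDITIONAL — a
real constructive-QFT result; it is NOT the continuum limit and NOT the Clay problem.  HONEST DEPENDENCY (cell reorg 2026-08-19,
verbatim): «continuum YM on T⁴ ⇐ BetaPertH ∧ nine spine estimates (0/9 proved); BetaPertH ⇐ (D1) ∧ (D4) ∧ CAP+tail; G-an2-4 gates
asym, D1 and NE2/3/4.»  THIS MODULE DISCHARGES NOTHING: [folklore] arithmetic on the family of PART 1 — β₁ := b, β₂(g₀, g₁) := b +
J(g₀)·g₁, β_{k+1} := b (k ≥ 2) — and on coupling tables that solve (0.20) FORWARD from the bare coupling with it, read through the NAMED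
FIELDS of the statement-exact typing of [I] = [Balaban1987RG1] (`B12BetaAsPrinted`, p537882 ✓ ∕ v1.1 p539116 ✓).  Every statement is
about settings `S` satisfying DEFINING HYPOTHESES (`hβ`, `hcpl`); nothing of Bałaban's objects is asserted.

THE MECHANISM.  Along a forward run the recursion (0.20) reads 1∕g₁² = 1∕g₀² − b and 1∕g₂² = 1∕g₁² − β₂(g₀, g₁) = 1∕g₀² − 2b −
J(g₀)·g₁ with g₁ = (1∕g₀² − b)^{−1∕2} (`readout_two`).  The renormalized value g with 1∕g² = z − 2b is therefore reached at depth
K = 2 from SOME bare coupling iff the equation 1∕g₀² − J(g₀)·(1∕g₀² − b)^{−1∕2} = z has a positive root.  When J is continuous the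
left side sweeps every large value (forward shooting, `FlowStep.continuousOn_Y`); when J jumps, values can be MISSED — and if
arbitrarily large values are missed (`hgap`), then for every g₁ > 0 some renormalized coupling g ≤ g₁ has NO tuned bare coupling
g₀(ε, g) at ε = L^{−2}, so `B12BetaAsPrinted.Theorem2Statement S hL` ([I] Theorem 2 ∕ (0.31) BY NAME, quantified «∀ K ∃ g₀») FAILS
(`not_theorem2Statement_of_gap`).  PART 3 exhibits such a J with 0 ≤ J ≤ x².

WHAT THIS FILE PROVES (0 sorry, 0 def):
§3 under `hcpl`: `run_zero`, `run_succ`, `run_step` (= the printed forward determination `d020`: `definitions_d020_of_histJump`),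
   `radicand_pos_of_succ_pos`, `inv_sq_succ`, `beta_prefix`, **`readout_two`**; `run_bound` ∕ **`runHyp_of_histJump`** ∕ `runs_every_depth`
   (from 1∕g₀² = 1∕γ² + K(b + 1): Theorem 3's run hypothesis `RunHyp S ⟨K, m, g₀⟩` at EVERY depth K — the interface's run-level conclusions
   are not vacuous for such settings).
§4 **`not_theorem2Statement_of_gap`** (`hcpl`, b > 0, `hgap` ⟹ ¬`Theorem2Statement S hL`).
NOT CLAIMED: anything about Bałaban's β or runs; Theorem 2 or its negation for the construction; continuum; Clay.
-/

namespace Summit.QuantumFields.BalabanUV.Beta.EriceFlowEnclosureB12AsPrintedHistoryJumpRuns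

open Literature.MathematicalPhysics.QuantumFieldTheory.Balaban1983to89
open Literature.MathematicalPhysics.QuantumFieldTheory.Balaban1983to89.B12BetaAsPrinted
open Literature.MathematicalPhysics.QuantumFieldTheory.Balaban1983to89.FlowStep (prefixOf Box mem_box)
open Summit.QuantumFields.BalabanUV.Beta.EriceFlowEnclosureB12AsPrintedUpper (tunedRuns_of_theorem2Statement)
open Summit.QuantumFields.BalabanUV.Beta.EriceFlowEnclosureB12AsPrintedHistoryJump

noncomputable section

variable {S : Setting} {b : ℝ} {J : ℝ → ℝ}

/-! ## §3 The runs: forward solutions of (0.20) with the history-jump family -/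

/-- The run starts at its bare coupling ((0.18) `Definitions.d018`). [cite: Balaban1987RG1, (0.17)–(0.18) p.255] -/
theorem run_zero
    (hcpl : ∀ (P : B12.RunParams) (k : ℕ), S.cpl P k = Nat.rec (motive := fun _ => ℝ) P.g0
      (fun k g => 1 / Real.sqrt (1 / g ^ 2 - (b + (if k = 1 then J P.g0 else 0) * g))) k)
    (P : B12.RunParams) : S.cpl P 0 = P.g0 := by
  rw [hcpl]; rfl

/-- The forward step of the coupling table: g_{k+1} = (1∕g_k² − β_{k+1}(g₀, …, g_k))^{−1∕2} (junk 0 once the run breaks off).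
[cite: Balaban1987RG1, (0.20) p.256] -/
theorem run_succ
    (hcpl : ∀ (P : B12.RunParams) (k : ℕ), S.cpl P k = Nat.rec (motive := fun _ => ℝ) P.g0
      (fun k g => 1 / Real.sqrt (1 / g ^ 2 - (b + (if k = 1 then J P.g0 else 0) * g))) k)
    (P : B12.RunParams) (k : ℕ) :
    S.cpl P (k + 1) = 1 / Real.sqrt (1 / (S.cpl P k) ^ 2 - (b + (if k = 1 then J P.g0 else 0) * S.cpl P k)) := by
  rw [hcpl, hcpl]

/-- One step in the printed forward-determination form: if the right side of (0.20) is positive at step k, then g_{k+1} > 0 and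
1∕g_k² = 1∕g_{k+1}² + β_{k+1}(g₀, …, g_k). [cite: Balaban1987RG1, (0.20) p.256] -/
theorem run_step
    (hcpl : ∀ (P : B12.RunParams) (k : ℕ), S.cpl P k = Nat.rec (motive := fun _ => ℝ) P.g0
      (fun k g => 1 / Real.sqrt (1 / g ^ 2 - (b + (if k = 1 then J P.g0 else 0) * g))) k)
    (P : B12.RunParams) (k : ℕ) (h : 0 < 1 / (S.cpl P k) ^ 2 - (b + (if k = 1 then J P.g0 else 0) * S.cpl P k)) :
    0 < S.cpl P (k + 1) ∧
      1 / (S.cpl P k) ^ 2 = 1 / (S.cpl P (k + 1)) ^ 2 + (b + (if k = 1 then J P.g0 else 0) * S.cpl P k) := by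
  rw [run_succ hcpl]
  refine ⟨one_div_pos.mpr (Real.sqrt_pos.mpr h), ?_⟩
  rw [div_pow, one_pow, Real.sq_sqrt h.le, one_div_one_div]
  ring

/-- A positive next coupling certifies that the right side of (0.20) was positive (the junk value is 0). [cite: Balaban1987RG1, (0.20) p.256] -/
theorem radicand_pos_of_succ_pos
    (hcpl : ∀ (P : B12.RunParams) (k : ℕ), S.cpl P k = Nat.rec (motive := fun _ => ℝ) P.g0
      (fun k g => 1 / Real.sqrt (1 / g ^ 2 - (b + (if k = 1 then J P.g0 else 0) * g))) k)
    (P : B12.RunParams) (k : ℕ) (hpos : 0 < S.cpl P (k + 1)) :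
    0 < 1 / (S.cpl P k) ^ 2 - (b + (if k = 1 then J P.g0 else 0) * S.cpl P k) := by
  rw [run_succ hcpl] at hpos
  by_contra hle
  rw [Real.sqrt_eq_zero'.mpr (not_lt.mp hle), div_zero] at hpos
  exact lt_irrefl _ hpos

/-- (0.20) solved for the next coupling along a live run: 1∕g_{k+1}² = 1∕g_k² − β_{k+1}(g₀, …, g_k). [cite: Balaban1987RG1, (0.20) p.256] -/
theorem inv_sq_succ
    (hcpl : ∀ (P : B12.RunParams) (k : ℕ), S.cpl P k = Nat.rec (motive := fun _ => ℝ) P.g0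
      (fun k g => 1 / Real.sqrt (1 / g ^ 2 - (b + (if k = 1 then J P.g0 else 0) * g))) k)
    (P : B12.RunParams) (k : ℕ) (hpos : 0 < S.cpl P (k + 1)) :
    1 / (S.cpl P (k + 1)) ^ 2 = 1 / (S.cpl P k) ^ 2 - (b + (if k = 1 then J P.g0 else 0) * S.cpl P k) := by
  have h := (run_step hcpl P k (radicand_pos_of_succ_pos hcpl P k hpos)).2
  linarith

/-- β read at the run's own prefix (g₀, …, g_k) is b + a_k(g₀)·g_k with g₀ = the run's bare coupling. [folklore] -/
theorem beta_prefix
    (hβ : ∀ (k : ℕ) (p : Fin (k + 1) → ℝ), S.β k p = b + (if k = 1 then J (p 0) else 0) * p (Fin.last k))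
    (hcpl : ∀ (P : B12.RunParams) (k : ℕ), S.cpl P k = Nat.rec (motive := fun _ => ℝ) P.g0
      (fun k g => 1 / Real.sqrt (1 / g ^ 2 - (b + (if k = 1 then J P.g0 else 0) * g))) k)
    (P : B12.RunParams) (k : ℕ) :
    S.β k (prefixOf (S.cpl P) k) = b + (if k = 1 then J P.g0 else 0) * S.cpl P k := by
  rw [hβ]
  simp only [FlowStep.prefixOf_apply, Fin.val_zero, Fin.val_last]
  rw [run_zero hcpl]

/-- **(0.20) IN ITS PRINTED FORWARD-DETERMINATION FORM (`Definitions.d020`) HOLDS for such a coupling table.** [cite: Balaban1987RG1, (0.20) p.256 with (2.15) p.268] -/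
theorem definitions_d020_of_histJump
    (hβ : ∀ (k : ℕ) (p : Fin (k + 1) → ℝ), S.β k p = b + (if k = 1 then J (p 0) else 0) * p (Fin.last k))
    (hcpl : ∀ (P : B12.RunParams) (k : ℕ), S.cpl P k = Nat.rec (motive := fun _ => ℝ) P.g0
      (fun k g => 1 / Real.sqrt (1 / g ^ 2 - (b + (if k = 1 then J P.g0 else 0) * g))) k) :
    ∀ (P : B12.RunParams) (k : ℕ), k < P.K → (∀ i, i ≤ k → 0 < S.cpl P i) →
      0 < 1 / (S.cpl P k) ^ 2 - S.β k (prefixOf (S.cpl P) k) →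
        0 < S.cpl P (k + 1) ∧ 1 / (S.cpl P k) ^ 2 = 1 / (S.cpl P (k + 1)) ^ 2 + S.β k (prefixOf (S.cpl P) k) := by
  intro P k _ _ h
  rw [beta_prefix hβ hcpl] at h ⊢
  exact run_step hcpl P k h

/-- **THE DEPTH-2 READ-OUT.**  Along a run alive up to step 2: b < 1∕g₀², g₁ = (1∕g₀² − b)^{−1∕2}, and
`1∕g₂² = 1∕g₀² − 2b − J(g₀)·g₁` — the history jump J(g₀) enters the renormalized value weighted by g₁. [cite: Balaban1987RG1, (0.20) p.256] -/
theorem readout_two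
    (hcpl : ∀ (P : B12.RunParams) (k : ℕ), S.cpl P k = Nat.rec (motive := fun _ => ℝ) P.g0
      (fun k g => 1 / Real.sqrt (1 / g ^ 2 - (b + (if k = 1 then J P.g0 else 0) * g))) k)
    (P : B12.RunParams) (h1 : 0 < S.cpl P 1) (h2 : 0 < S.cpl P 2) :
    b < 1 / P.g0 ^ 2 ∧ S.cpl P 1 = 1 / Real.sqrt (1 / P.g0 ^ 2 - b) ∧
      1 / (S.cpl P 2) ^ 2 = 1 / P.g0 ^ 2 - 2 * b - J P.g0 * S.cpl P 1 := by
  have r1 := radicand_pos_of_succ_pos hcpl P 0 h1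
  have e1 := inv_sq_succ hcpl P 0 h1
  have s1 := run_succ hcpl P 0
  have e2 := inv_sq_succ hcpl P 1 h2
  have hz : (if (0 : ℕ) = 1 then J P.g0 else 0) = 0 := if_neg (by norm_num)
  have ho : (if (1 : ℕ) = 1 then J P.g0 else 0) = J P.g0 := if_pos rfl
  rw [hz, run_zero hcpl] at r1 e1 s1
  rw [ho] at e2
  simp only [zero_mul, add_zero] at r1 e1 s1
  refine ⟨by linarith, s1, ?_⟩
  rw [e2, e1]; ring

/-- **The run from a small bare coupling reaches every prescribed depth inside ]0, γ]**: with 1∕g₀² = 1∕γ² + K(b + 1) (γ ≤ 1, b ≥ 0,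
0 ≤ J ≤ x²) one has g_k > 0 and 1∕g_k² ≥ 1∕γ² + (K − k)(b + 1) for k ≤ K (each live step subtracts β_{k+1} ≤ b + g₀²·g_k ≤ b + 1).
[cite: Balaban1987RG1, (0.20) p.256 with Thm 3 p.264] -/
theorem run_bound
    (hcpl : ∀ (P : B12.RunParams) (k : ℕ), S.cpl P k = Nat.rec (motive := fun _ => ℝ) P.g0
      (fun k g => 1 / Real.sqrt (1 / g ^ 2 - (b + (if k = 1 then J P.g0 else 0) * g))) k)
    (hb : 0 ≤ b) (hJ0 : ∀ x, 0 ≤ J x) (hJsq : ∀ x, J x ≤ x ^ 2) {γ : ℝ} (hγ : 0 < γ) (hγ1 : γ ≤ 1)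
    {P : B12.RunParams} (hg₀ : 0 < P.g0) (h0 : 1 / P.g0 ^ 2 = 1 / γ ^ 2 + (P.K : ℝ) * (b + 1)) :
    ∀ k, k ≤ P.K → 0 < S.cpl P k ∧ 1 / γ ^ 2 + ((P.K : ℝ) - k) * (b + 1) ≤ 1 / (S.cpl P k) ^ 2 := by
  have hγ2 : 0 < γ ^ 2 := pow_pos hγ 2
  have hγinv : 1 ≤ 1 / γ ^ 2 := by
    rw [le_div_iff₀ hγ2, one_mul]; exact pow_le_one₀ hγ.le hγ1
  -- the bare coupling is at most 1
  have hg₀1 : P.g0 ≤ 1 := by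
    have h1 : 1 ≤ 1 / P.g0 ^ 2 := by rw [h0]; nlinarith [Nat.cast_nonneg (α := ℝ) P.K]
    have h2 : P.g0 ^ 2 ≤ 1 := by rwa [le_one_div one_pos (pow_pos hg₀ 2), div_one] at h1
    nlinarith
  obtain ⟨hs0, hssq⟩ := slope_bounds hJ0 hJsq 1 P.g0
  have hslope1 : ∀ k : ℕ, 0 ≤ (if k = 1 then J P.g0 else 0) ∧ (if k = 1 then J P.g0 else 0) ≤ 1 := by
    intro k
    obtain ⟨h0', hsq'⟩ := slope_bounds hJ0 hJsq k P.g0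
    exact ⟨h0', hsq'.trans (by nlinarith)⟩
  intro k
  induction k with
  | zero =>
    intro _
    rw [run_zero hcpl, h0]
    exact ⟨hg₀, by simp⟩
  | succ k ih =>
    intro hk
    obtain ⟨hpos, hbnd⟩ := ih (Nat.le_of_succ_le hk)
    have hkK : (k : ℝ) + 1 ≤ P.K := by exact_mod_cast hk
    have hge : 1 / γ ^ 2 ≤ 1 / (S.cpl P k) ^ 2 := by nlinarith
    have hsq : (S.cpl P k) ^ 2 ≤ γ ^ 2 := (one_div_le_one_div hγ2 (pow_pos hpos 2)).mp hge
    have hle : S.cpl P k ≤ 1 := by nlinarith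
    obtain ⟨ha0, ha1⟩ := hslope1 k
    have hprod : (if k = 1 then J P.g0 else 0) * S.cpl P k ≤ 1 := by nlinarith
    have hrad : 0 < 1 / (S.cpl P k) ^ 2 - (b + (if k = 1 then J P.g0 else 0) * S.cpl P k) := by nlinarith
    obtain ⟨hpos', heq⟩ := run_step hcpl P k hrad
    refine ⟨hpos', ?_⟩
    push_cast
    nlinarith

/-- **THEOREM 3's RUN HYPOTHESIS HOLDS for the run (K, m, g₀) with 1∕g₀² = 1∕γ² + K(b + 1)** (γ = S.γ ∈ ]0, 1]): (0.20) along it, β read at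
the run's own prefixes, and 0 < g_k ≤ γ for k ≤ K. [cite: Balaban1987RG1, Thm 3 p.264 with (0.20) p.256] -/
theorem runHyp_of_histJump
    (hβ : ∀ (k : ℕ) (p : Fin (k + 1) → ℝ), S.β k p = b + (if k = 1 then J (p 0) else 0) * p (Fin.last k))
    (hcpl : ∀ (P : B12.RunParams) (k : ℕ), S.cpl P k = Nat.rec (motive := fun _ => ℝ) P.g0
      (fun k g => 1 / Real.sqrt (1 / g ^ 2 - (b + (if k = 1 then J P.g0 else 0) * g))) k)
    (hb : 0 ≤ b) (hJ0 : ∀ x, 0 ≤ J x) (hJsq : ∀ x, J x ≤ x ^ 2) (hγ : 0 < S.γ) (hγ1 : S.γ ≤ 1)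
    {P : B12.RunParams} (hg₀ : 0 < P.g0) (h0 : 1 / P.g0 ^ 2 = 1 / S.γ ^ 2 + (P.K : ℝ) * (b + 1)) : RunHyp S P := by
  have hB := run_bound hcpl hb hJ0 hJsq hγ hγ1 hg₀ h0
  refine ⟨fun k hk => ?_, fun k hk => ?_⟩
  · obtain ⟨hpos1, _⟩ := hB (k + 1) hk
    rw [beta_prefix hβ hcpl]
    have e := inv_sq_succ hcpl P k hpos1
    linarith
  · obtain ⟨hpos, hbnd⟩ := hB k hk
    have hkK : (k : ℝ) ≤ P.K := by exact_mod_cast hk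
    have hge : 1 / S.γ ^ 2 ≤ 1 / (S.cpl P k) ^ 2 := by nlinarith
    have hsq : (S.cpl P k) ^ 2 ≤ S.γ ^ 2 := (one_div_le_one_div (pow_pos hγ 2) (pow_pos hpos 2)).mp hge
    exact ⟨hpos, by nlinarith⟩

/-- **RUNS THEOREM 3 SPEAKS OF, AT EVERY DEPTH**: for every K and m there is a bare coupling g₀ > 0 with `RunHyp S ⟨K, m, g₀⟩`
(γ = S.γ ∈ ]0, 1], b ≥ 0, 0 ≤ J ≤ x²) — the interface's run-level conclusions are not vacuous for such settings. [cite: Balaban1987RG1, Thm 3 p.264] -/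
theorem runs_every_depth
    (hβ : ∀ (k : ℕ) (p : Fin (k + 1) → ℝ), S.β k p = b + (if k = 1 then J (p 0) else 0) * p (Fin.last k))
    (hcpl : ∀ (P : B12.RunParams) (k : ℕ), S.cpl P k = Nat.rec (motive := fun _ => ℝ) P.g0
      (fun k g => 1 / Real.sqrt (1 / g ^ 2 - (b + (if k = 1 then J P.g0 else 0) * g))) k)
    (hb : 0 ≤ b) (hJ0 : ∀ x, 0 ≤ J x) (hJsq : ∀ x, J x ≤ x ^ 2) (hγ : 0 < S.γ) (hγ1 : S.γ ≤ 1) (K m : ℕ) :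
    ∃ g₀ : ℝ, 0 < g₀ ∧ RunHyp S ⟨K, m, g₀⟩ := by
  have hA : 0 < 1 / S.γ ^ 2 + (K : ℝ) * (b + 1) := by positivity
  refine ⟨1 / Real.sqrt (1 / S.γ ^ 2 + (K : ℝ) * (b + 1)), by positivity,
    runHyp_of_histJump hβ hcpl hb hJ0 hJsq hγ hγ1 (P := ⟨K, m, _⟩) (by positivity) ?_⟩
  show 1 / (1 / Real.sqrt (1 / S.γ ^ 2 + (K : ℝ) * (b + 1))) ^ 2 = 1 / S.γ ^ 2 + (K : ℝ) * (b + 1)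
  rw [div_pow, one_pow, Real.sq_sqrt hA.le, one_div_one_div]

/-! ## §4 A missed renormalized value at depth 2 defeats Theorem 2 as printed -/

/-- **¬ THEOREM 2 AS PRINTED FROM A GAP IN THE DEPTH-2 READ-OUT.**  If the coupling table solves (0.20) forward with the history-jump
family (b > 0) and the read-out map g₀ ↦ 1∕g₀² − J(g₀)·(1∕g₀² − b)^{−1∕2} MISSES arbitrarily large values z, then
`Theorem2Statement S hL` — [I] Theorem 2 ∕ (0.31) BY NAME for the run family (0.20) defines — is FALSE: given Theorem 2's γ₀ and g₁,
the renormalized coupling g = (z − 2b)^{−1∕2} ≤ g₁ (z ≥ 1∕g₁² + 2b missed) admits no bare coupling with g₂ = g at K = 2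
(`readout_two`). [cite: Balaban1987RG1, Thm 2 (0.31) p.259 with (0.20) p.256 and p.298] -/
theorem not_theorem2Statement_of_gap
    (hcpl : ∀ (P : B12.RunParams) (k : ℕ), S.cpl P k = Nat.rec (motive := fun _ => ℝ) P.g0
      (fun k g => 1 / Real.sqrt (1 / g ^ 2 - (b + (if k = 1 then J P.g0 else 0) * g))) k)
    (hgap : ∀ z₀ : ℝ, ∃ z : ℝ, z₀ ≤ z ∧ ∀ x : ℝ, 0 < x → b < 1 / x ^ 2 →
      1 / x ^ 2 - J x * (1 / Real.sqrt (1 / x ^ 2 - b)) ≠ z)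
    {hL : Odd S.L ∧ 1 < S.L} : ¬ Theorem2Statement S hL := by
  intro h
  obtain ⟨γ₀, hγ₀, hγ⟩ := tunedRuns_of_theorem2Statement h 0
  obtain ⟨g₁, hg₁, hg⟩ := hγ γ₀ hγ₀ le_rfl
  obtain ⟨z, hz, hzgap⟩ := hgap (1 / g₁ ^ 2 + 2 * b)
  have hg₁sq : 0 < 1 / g₁ ^ 2 := one_div_pos.mpr (pow_pos hg₁ 2)
  have hzb : 0 < z - 2 * b := by linarith
  set g : ℝ := 1 / Real.sqrt (z - 2 * b) with hgdef
  have hgpos : 0 < g := by positivity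
  have hgsq : 1 / g ^ 2 = z - 2 * b := by
    rw [hgdef, div_pow, one_pow, Real.sq_sqrt hzb.le, one_div_one_div]
  have hgle : g ≤ g₁ := by
    have h1 : 1 / g₁ ^ 2 ≤ 1 / g ^ 2 := by rw [hgsq]; linarith
    have h2 : g ^ 2 ≤ g₁ ^ 2 := (one_div_le_one_div (pow_pos hg₁ 2) (pow_pos hgpos 2)).mp h1
    nlinarith
  obtain ⟨β, β', -, -, hK⟩ := hg g hgpos hgle
  obtain ⟨g₀, hI, hend, -⟩ := hK 2
  have h0 := (hI 0 (by norm_num)).1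
  have h1 := (hI 1 (by norm_num)).1
  have h2 := (hI 2 le_rfl).1
  rw [run_zero hcpl] at h0
  obtain ⟨hbg, hc1, hread⟩ := readout_two hcpl ⟨2, 0, g₀⟩ h1 h2
  rw [hend, hgsq, hc1] at hread
  dsimp only at h0 hbg hread
  exact hzgap g₀ h0 hbg (by linarith)

end

end Summit.QuantumFields.BalabanUV.Beta.EriceFlowEnclosureB12AsPrintedHistoryJumpRuns
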